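import Mathlib
import Summits.ResolutionOfSingularities.ResolutionOfSingularities.Theorems.WeightedInvariantLocalWeightedDropTOT2NoLinePrimeBranch
import Summits.ResolutionOfSingularities.ResolutionOfSingularities.Theorems.WeightedInvariantLocalWeightedDropTOT2DictionaryTwo

/-!
# TOT2-LINE (P3) brick D8, part 3/3: `X_one_not_mem_of_wellPrepared` — NO LINE-TYPE TOP-LOCUS PRIME ON A WELL-PREPARED NON-`Perm2` POSITION

Sub-problem `ResolutionOfSingularities`, ENGINE crux `stmt-ResolutionOfSingularities-8899` (`LocalWeightedDrop`), skeleton v35 (2e806da509994632),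
registered stub `stub_conflictBudget` (P3); dictionary brick **D8 `X_one_not_mem_of_wellPrepared`** — the hypothesis `hNL` of the graph step of the
conflict budget (res-L1-w43-stub-2 g6 WANT-HAND 2026-08-27T21:24:55Z, exact target; res-L1-w43-plan-1 RULING 21:25:12Z; this hand res-L1-w43-stub-1 g7).
[OURS · L1 W4.3 · chain w43.  Engine bookkeeping: nothing here is a statement of any manuscript; AI-produced, gate-checked, weaker than expert review.
«[OURS · L1 W4.3] replaces the role of nothing printed; NOT a statement of the manuscript.»]

* §5 the weight `w = (0,1,1)`: elements of `Q₀ = ker κ₁ = (u₂, y)` have weighted order `≥ 1`, of `Q₀^n` order `≥ n`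
  (`le_weightedOrder_of_mem_ker_pow`), elements outside `Q₀` order `0`; the weighted order is additive on products (Mathlib `weightedOrder_mul`);
* §6 weight `≥ d` of a monic germ `y^d + Σ B_j y^j` is exactly `IsPermissibleTwoT d B` (`coeff_monicGerm_slot`, `isPermissibleTwoT_of_le_weightedOrder`);
* §7 **`X_one_not_mem_of_wellPrepared`** (res-L1-w43-stub-2's exact target): `WellPrepared d A`, `IsPosT d A`, `¬ IsPermissibleTwoT d A`, `P ∈ topPrimes d A`
  one-dimensional with `X 0 ∉ P` ⇒ `X 1 ∉ P`.
-/

set_option linter.dupNamespace false -- mandated namespace of this single-conjunct summit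

noncomputable section

namespace Summit.ResolutionOfSingularities.ResolutionOfSingularities.Theorems

namespace TOT2Branch

open MvPowerSeries IsLocalRing

variable {k : Type} [Field k]

/-! ## §5 The weight `(0,1,1)`: it sees the ideal `Q₀ = (u₂, y) = ker (κ₁ : (u₁,u₂,y) ↦ (u₁,0,0))` -/

/-- The weight `(0,1,1)` of an exponent: `x₁ + x₂`. -/
theorem weight_lineW (x : Fin 3 →₀ ℕ) : Finsupp.weight (![0, 1, 1] : Fin 3 → ℕ) x = x 1 + x 2 := by
  rw [Finsupp.weight_apply, Finsupp.sum_fintype _ _ (fun i => by simp), Fin.sum_univ_three]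
  simp

/-- Exponents of weight zero are pure powers of `u₁`, i.e. come from the `u₁`-axis. -/
theorem eq_embDomain_of_weight_eq_zero {x : Fin 3 →₀ ℕ} (hx : Finsupp.weight (![0, 1, 1] : Fin 3 → ℕ) x = 0) :
    x = Finsupp.embDomain ((Fin.succAboveEmb (1 : Fin 2)).trans (Fin.succAboveEmb (1 : Fin 3))) (Finsupp.single 0 (x 0)) := by
  rw [weight_lineW] at hx
  rw [Finsupp.embDomain_single, axisEmb_apply]
  ext i
  fin_cases i
  · simp
  · simp only [Finsupp.single_apply]; rw [if_neg (by decide)]; change x 1 = 0; omega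
  · simp only [Finsupp.single_apply]; rw [if_neg (by decide)]; change x 2 = 0; omega

/-- Elements of `Q₀` have weight `≥ 1`. -/
theorem one_le_weightedOrder_of_killCompl_eq_zero {b : MvPowerSeries (Fin 3) k}
    (hb : killCompl ((Fin.succAboveEmb (1 : Fin 2)).trans (Fin.succAboveEmb (1 : Fin 3))) b = 0) :
    (1 : ℕ∞) ≤ b.weightedOrder (![0, 1, 1] : Fin 3 → ℕ) := by
  refine nat_le_weightedOrder _ (n := 1) fun x hx => ?_
  have hx0 : Finsupp.weight (![0, 1, 1] : Fin 3 → ℕ) x = 0 := by omega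
  rw [eq_embDomain_of_weight_eq_zero hx0, ← coeff_killCompl, hb, map_zero]

/-- **Elements of `Q₀^n` have weight `≥ n`.** -/
theorem le_weightedOrder_of_mem_ker_pow (n : ℕ) {G : MvPowerSeries (Fin 3) k}
    (hG : G ∈ RingHom.ker ((killCompl ((Fin.succAboveEmb (1 : Fin 2)).trans (Fin.succAboveEmb (1 : Fin 3))) :
      MvPowerSeries (Fin 3) k →ₐ[k] MvPowerSeries (Fin 1) k).toRingHom) ^ n) :
    (n : ℕ∞) ≤ G.weightedOrder (![0, 1, 1] : Fin 3 → ℕ) := by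
  induction n generalizing G with
  | zero => simp
  | succ n ih =>
    rw [pow_succ] at hG
    refine Submodule.mul_induction_on hG (fun a ha b hb => ?_) (fun x y hx hy => ?_)
    · have hb' : killCompl ((Fin.succAboveEmb (1 : Fin 2)).trans (Fin.succAboveEmb (1 : Fin 3))) b = 0 := hb
      calc ((n + 1 : ℕ) : ℕ∞) = (n : ℕ∞) + 1 := by push_cast; rfl
        _ ≤ a.weightedOrder (![0, 1, 1] : Fin 3 → ℕ) + b.weightedOrder (![0, 1, 1] : Fin 3 → ℕ) :=
          add_le_add (ih ha) (one_le_weightedOrder_of_killCompl_eq_zero hb')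
        _ ≤ (a * b).weightedOrder (![0, 1, 1] : Fin 3 → ℕ) := le_weightedOrder_mul _
    · exact le_trans (le_min hx hy) (min_weightedOrder_le_add _)

/-- Elements outside `Q₀` have weight `0`. -/
theorem weightedOrder_eq_zero_of_killCompl_ne_zero {t : MvPowerSeries (Fin 3) k}
    (ht : killCompl ((Fin.succAboveEmb (1 : Fin 2)).trans (Fin.succAboveEmb (1 : Fin 3))) t ≠ 0) :
    t.weightedOrder (![0, 1, 1] : Fin 3 → ℕ) = 0 := by
  obtain ⟨x, hx⟩ : ∃ x, coeff x (killCompl ((Fin.succAboveEmb (1 : Fin 2)).trans (Fin.succAboveEmb (1 : Fin 3))) t) ≠ 0 := by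
    by_contra h
    push Not at h
    exact ht (MvPowerSeries.ext fun x => by rw [h x, map_zero])
  rw [coeff_killCompl] at hx
  have h1 := weightedOrder_le (w := (![0, 1, 1] : Fin 3 → ℕ)) hx
  have h2 : Finsupp.weight (![0, 1, 1] : Fin 3 → ℕ)
      (Finsupp.embDomain ((Fin.succAboveEmb (1 : Fin 2)).trans (Fin.succAboveEmb (1 : Fin 3))) x) = 0 := by
    rw [Finsupp.unique_single x, Finsupp.embDomain_single, Fin.default_eq_zero, axisEmb_apply, weight_lineW]
    simp
  rw [h2] at h1
  exact nonpos_iff_eq_zero.mp (by exact_mod_cast h1)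

/-! ## §6 Reading the weight of the re-centred monic germ: `V(y,u₂)`-permissibility -/

/-- **Coefficient extraction from the monic germ**: the coefficient of `u^e y^j` (`j < d`) in `y^d + Σ B_l y^l` is the coefficient of `u^e` in
`B_j`. -/
theorem coeff_monicGerm_slot {d : ℕ} (B : Fin d → MvPowerSeries (Fin 2) k) (j : Fin d) (e : Fin 2 →₀ ℕ) :
    coeff (Finsupp.embDomain (Fin.succAboveEmb (Fin.last 2)) e + Finsupp.single (Fin.last 2) (j : ℕ)) (NCPoly.monicGerm d B) = coeff e (B j) := by
  classical
  have hlast : ∀ e' : Fin 2 →₀ ℕ, (Finsupp.embDomain (Fin.succAboveEmb (Fin.last 2)) e') (Fin.last 2) = 0 := fun e' =>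
    Finsupp.embDomain_notin_range _ _ _ (by rintro ⟨i, hi⟩; exact Fin.succAbove_ne _ _ hi)
  rw [NCPoly.monicGerm, map_add, map_sum]
  have h1 : coeff (Finsupp.embDomain (Fin.succAboveEmb (Fin.last 2)) e + Finsupp.single (Fin.last 2) (j : ℕ))
      ((X (Fin.last 2) : MvPowerSeries (Fin 3) k) ^ d) = 0 := by
    rw [X_pow_eq, coeff_monomial, if_neg]
    intro h
    have h' := congrArg (fun f : Fin 3 →₀ ℕ => f (Fin.last 2)) h
    simp only [Finsupp.add_apply, hlast, Finsupp.single_eq_same, zero_add] at h'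
    exact absurd h' (ne_of_lt j.2)
  rw [h1, zero_add, Finset.sum_eq_single j (fun l _ hl => ?_) (fun h => absurd (Finset.mem_univ j) h)]
  · rw [X_pow_eq, coeff_mul_monomial, if_pos le_add_self, mul_one, add_tsub_cancel_right]
    change coeff _ (rename _ (B j)) = _
    rw [coeff_embDomain_rename]
  · rw [X_pow_eq, coeff_mul_monomial]
    split_ifs with hle
    · rw [mul_one]
      refine coeff_toThree_eq_zero (B l) ?_
      rw [Finsupp.tsub_apply, Finsupp.add_apply, hlast, zero_add, Finsupp.single_eq_same, Finsupp.single_eq_same]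
      have hlj : (l : ℕ) ≤ j := by
        have := hle (Fin.last 2)
        simp only [Finsupp.single_eq_same, Finsupp.add_apply, hlast, zero_add] at this
        exact this
      have hne : (l : ℕ) ≠ j := fun h => hl (Fin.ext h)
      omega
    · rfl

/-- **Weight `≥ d` of the monic germ of `B` means `V(y,u₂)` is permissible for `B`.** -/
theorem isPermissibleTwoT_of_le_weightedOrder {d : ℕ} {B : Fin d → MvPowerSeries (Fin 2) k}
    (h : (d : ℕ∞) ≤ (NCPoly.monicGerm d B).weightedOrder (![0, 1, 1] : Fin 3 → ℕ)) : PolyDescent.IsPermissibleTwoT d B := by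
  intro j e he
  have hc : coeff (Finsupp.embDomain (Fin.succAboveEmb (Fin.last 2)) e + Finsupp.single (Fin.last 2) (j : ℕ)) (NCPoly.monicGerm d B) ≠ 0 := by
    rw [coeff_monicGerm_slot]; exact he
  have h1 := weightedOrder_le (w := (![0, 1, 1] : Fin 3 → ℕ)) hc
  have h2 : Finsupp.weight (![0, 1, 1] : Fin 3 → ℕ)
      (Finsupp.embDomain (Fin.succAboveEmb (Fin.last 2)) e + Finsupp.single (Fin.last 2) (j : ℕ)) = e 1 + j := by
    rw [weight_lineW]
    have hE1 : (Finsupp.embDomain (Fin.succAboveEmb (Fin.last 2)) e) 1 = e 1 := by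
      rw [show (1 : Fin 3) = Fin.succAboveEmb (Fin.last 2) (1 : Fin 2) from rfl, Finsupp.embDomain_apply_self]
    have hE2 : (Finsupp.embDomain (Fin.succAboveEmb (Fin.last 2)) e) 2 = 0 :=
      Finsupp.embDomain_notin_range _ _ _ (by rintro ⟨i, hi⟩; exact Fin.succAbove_ne _ _ hi)
    simp only [Finsupp.add_apply, hE1, hE2, Finsupp.single_apply]
    rw [if_neg (show (Fin.last 2 : Fin 3) ≠ 1 by decide), if_pos (show (Fin.last 2 : Fin 3) = 2 from rfl)]
    omega
  have h3 := h.trans h1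
  rw [h2] at h3
  have h4 : d ≤ e 1 + j := by exact_mod_cast h3
  omega

/-! ## §7 D8: no one-dimensional top-locus prime of a well-prepared, non-`Perm2` position contains `u₂` (unless it contains `u₁`) -/

/-- A position has coefficients without constant term. -/
theorem constantCoeff_eq_zero_of_isPosT {d : ℕ} {A : Fin d → MvPowerSeries (Fin 2) k} (hpos : PolyDescent.IsPosT d A) (j : Fin d) :
    constantCoeff (A j) = 0 := by
  have h := hpos j
  have h1 : 1 ≤ (A j).order := Order.one_le_iff_pos.mpr (lt_of_le_of_lt bot_le h)
  exact (one_le_order_iff_constCoeff_eq_zero).mp h1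

/-- **B5-D8 — NO LINE-TYPE TOP-LOCUS PRIME ON A WELL-PREPARED NON-`Perm2` POSITION** (res-L1-w43-stub-2's exact target, the hypothesis `hNL` of the
graph step): for a well-prepared position `A` with `V(y,u₂)` NOT permissible, a one-dimensional top-locus prime not containing `u₁` does not contain
`u₂`.  (If it did: its plane contraction is `(g)` with `∂g/∂y(0) ≠ 0` (§2), so the branch is a graph `y = φ(u₁)` (§3) and `P = σ_φ⁻¹(u₂, y)` (§4);
then `s F ∈ P^d` makes the re-centred germ `F_φ` of weight `≥ d` for the weight `(0,1,1)` (§5), i.e. `V(y,u₂)` permissible for `shift d A φ` (§6),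
hence for `A` by minimality of well-prepared positions (`isPermissibleTwoT_of_shift`) — contradiction.) -/
theorem X_one_not_mem_of_wellPrepared {d : ℕ} (hd : 0 < d) {A : Fin d → MvPowerSeries (Fin 2) k} (hWP : PolyDescent.WellPrepared d A)
    (hpos : PolyDescent.IsPosT d A) (h2 : ¬ PolyDescent.IsPermissibleTwoT d A) {P : Ideal (MvPowerSeries (Fin 3) k)} (hP : P ∈ topPrimes d A)
    (hdim : ringKrullDim (MvPowerSeries (Fin 3) k ⧸ P) = 1) (hX0 : (X 0 : MvPowerSeries (Fin 3) k) ∉ P) :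
    (X 1 : MvPowerSeries (Fin 3) k) ∉ P := by
  intro hX1
  haveI := hP.1
  obtain ⟨s, hs, hsF⟩ := hP.2.2
  have hA : ∀ j, constantCoeff (A j) = 0 := constantCoeff_eq_zero_of_isPosT hpos
  obtain ⟨g, -, hQg, hg0, hg1⟩ := exists_generator_comap hd hA hX1 hX0 hs hsF
  obtain ⟨φ, hφ0, hφ, hgφ⟩ := exists_branch_of_coeff_ne_zero hg0 hg1
  have hPeq := eq_comap_recentre_ker hdim hX1 hQg hφ0 hφ hgφ
  set σ : MvPowerSeries (Fin 3) k →ₐ[k] MvPowerSeries (Fin 3) k :=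
    substAlgHom (hasSubst_of_constantCoeff_zero (NCPoly.constantCoeff_recentre hφ0)) with hσ
  set κ₁ : MvPowerSeries (Fin 3) k →ₐ[k] MvPowerSeries (Fin 1) k :=
    killCompl ((Fin.succAboveEmb (1 : Fin 2)).trans (Fin.succAboveEmb (1 : Fin 3))) with hκ₁
  -- transport of the symbolic power along `σ`
  have h1 : σ s * σ (NCPoly.monicGerm d A) ∈ RingHom.ker κ₁.toRingHom ^ d := by
    have h := hsF
    rw [hPeq] at h
    have h' := Ideal.le_comap_pow _ d h
    rw [Ideal.mem_comap, map_mul] at h'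
    exact h'
  have hσs : κ₁ (σ s) ≠ 0 := by
    intro h0
    apply hs
    rw [hPeq, Ideal.mem_comap, RingHom.mem_ker]
    exact h0
  have hσF : σ (NCPoly.monicGerm d A) = NCPoly.monicGerm d (WildMonic.shift d A φ) := by
    rw [hσ, substAlgHom_apply]; exact NCPoly.subst_recentre_monicGerm hφ0 d A
  -- weighted orders
  have hd_le := le_weightedOrder_of_mem_ker_pow d h1
  rw [weightedOrder_mul, weightedOrder_eq_zero_of_killCompl_ne_zero hσs, zero_add, hσF] at hd_le
  exact h2 (isPermissibleTwoT_of_shift hd hWP hpos hφ0 (isPermissibleTwoT_of_le_weightedOrder hd_le))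

end TOT2Branch

end Summit.ResolutionOfSingularities.ResolutionOfSingularities.Theorems

end
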